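/-
Copyright (c) 2026. Released under Apache 2.0 license.
-/
import Summits.RiemannHypothesis.RiemannHypothesis.Theorems.MotivicDoorSemilocalThreshold
import Summits.RiemannHypothesis.RiemannHypothesis.Theorems.GroundBartaEvenWinsBeyondArchPositivity8046
import Mathlib.Analysis.Complex.ExponentialBounds
import HarnessLib

/-!
# The semi-local threshold `a*(S)` for `2, 3 ∈ S`: lower end `4023/5000 = 0.8046`

Cell `rh-explicit` (HOME `run/shared/lean/pub/rh-explicit/`), seat cc-s2-2; RH DATA BLITZ target A4
(«a first `a*({∞,2,3})` bracket»), lower end, as a THEOREM about the tree's object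
`weilSemilocalThreshold` (`MotivicDoorSemilocalThreshold.lean`).

On every window `a ≤ (log 5)/2` the `S`-smooth semi-local Weil form of an `S ∋ 2, 3` IS the full Weil form
(only the prime powers `2, 3, 4 < e^{2a} ≤ 5` enter; `weilSemilocalPositivityOn_iff_weilPositivityOn_of_le`,
`MotivicDoorSemilocalClosed.lean`), so the PROVED frontier rung of the full ladder,
`WeilPositivityOn (4023/5000)` (`EvenWinsBeyondArch.weilPositivityOn_8046`,
`GroundBartaEvenWinsBeyondArchPositivity8046.lean`; `4023/5000 = 0.8046 < (log 5)/2 = 0.80471…`),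
transports verbatim: `WeilSemilocalPositivityOn S (4023/5000)`, hence `4023/5000 ≤ a*(S)` — superseding the
tree's `59/100` (`le_weilSemilocalThreshold_of_two_three`).  The proved lower end misses the coincidence
window `(log 5)/2` of `{2, 3}` by `< 1.2·10⁻⁴` (`log_five_half_sub_lt`); under RH the threshold reaches the
window (`le_weilSemilocalThreshold_of_riemannHypothesis`, here specialised).  DATA (cell rh-explicit, cc-s2-3,
kit j144458/j144939, one lineage): the finite-section zero of the `{∞,2,3}` form sits at `≈ 0.807–0.808`.
Honest framing: theorems about the TREE's object `weilSemilocalThreshold`; no statement about `ζ`, no RH claim.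
Pure proof file (no new definitions).
-/

set_option linter.dupNamespace false  -- the mandated namespace repeats `RiemannHypothesis`

noncomputable section

open Real
open Literature.NumberTheory.LFunctions
open Summit.RiemannHypothesis.RiemannHypothesis.Theorems.MotivicDoor.Semilocal
open Summit.RiemannHypothesis.RiemannHypothesis.Theorems.MotivicDoor.SemilocalThreshold

namespace Summit.RiemannHypothesis.RiemannHypothesis.Theorems.SemilocalTwoThree

variable {S : Finset ℕ}

/-- `4023/5000 = 0.8046 < (log 5)/2 = 0.804718…`: the frontier rung lies inside the coincidence window of `{2, 3}`. [folklore] -/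
theorem lt_log_five_half : (4023 / 5000 : ℝ) < Real.log 5 / 2 := by
  have := Real.log_five_gt_d9
  linarith

/-- … and misses it by less than `1.2·10⁻⁴`: `(log 5)/2 − 4023/5000 < 12/10⁵`. [folklore] -/
theorem log_five_half_sub_lt : Real.log 5 / 2 - 4023 / 5000 < (12 : ℝ) / 100000 := by
  have := Real.log_five_lt_d9
  linarith

/-- If `2, 3 ∈ S` then every prime power `≤ 4` is `S`-smooth. [folklore] -/
theorem primeFactors_subset_of_two_three (h2 : 2 ∈ S) (h3 : 3 ∈ S) :
    ∀ n ≤ 4, IsPrimePow n → n.primeFactors ⊆ S := by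
  have h23 : ({2, 3} : Finset ℕ) ⊆ S := by
    intro p hp
    simp only [Finset.mem_insert, Finset.mem_singleton] at hp
    rcases hp with rfl | rfl
    · exact h2
    · exact h3
  exact fun n hn hp ↦ (primeFactors_subset_of_le_four n hn hp).trans h23

/-- **`{∞} ∪ S`-positivity on `C(4023/5000)` for every `S ∋ 2, 3`**: there the semi-local form is the full Weil
form and the frontier rung `WeilPositivityOn (4023/5000)` applies. [cite: Bombieri2000Weil, §4 (criterion); certificate in tree] -/
theorem weilSemilocalPositivityOn_8046 (h2 : 2 ∈ S) (h3 : 3 ∈ S) :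
    WeilSemilocalPositivityOn S (4023 / 5000) := by
  have ha : (4023 / 5000 : ℝ) ≤ Real.log (((4 : ℕ) : ℝ) + 1) / 2 := by
    rw [log_five_half_eq]
    exact lt_log_five_half.le
  exact (weilSemilocalPositivityOn_iff_weilPositivityOn_of_le (primeFactors_subset_of_two_three h2 h3) ha).2
    EvenWinsBeyondArch.weilPositivityOn_8046

/-- … and on every narrower window. [folklore] -/
theorem weilSemilocalPositivityOn_of_le_8046 (h2 : 2 ∈ S) (h3 : 3 ∈ S) {a : ℝ} (ha : a ≤ 4023 / 5000) :
    WeilSemilocalPositivityOn S a :=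
  (weilSemilocalPositivityOn_8046 h2 h3).mono ha

/-- **Lower end of the `{∞,2,3}` bracket: `4023/5000 = 0.8046 ≤ a*(S)` for every finite `S ∋ 2, 3`.** [folklore] -/
theorem le_weilSemilocalThreshold_of_two_three_8046 (h2 : 2 ∈ S) (h3 : 3 ∈ S) :
    (4023 / 5000 : ℝ) ≤ weilSemilocalThreshold S :=
  le_weilSemilocalThreshold (weilSemilocalPositivityOn_8046 h2 h3)

/-- The case `S = {2, 3}` itself: `0.8046 ≤ a*({2,3})`. [folklore] -/
theorem le_weilSemilocalThreshold_two_three_8046 :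
    (4023 / 5000 : ℝ) ≤ weilSemilocalThreshold ({2, 3} : Finset ℕ) :=
  le_weilSemilocalThreshold_of_two_three_8046 (by decide) (by decide)

/-- The door reading for `{2, 3}`: under RH the threshold of any `S ∋ 2, 3` reaches the coincidence window
`(log 5)/2` (instance `N = 4` of `le_weilSemilocalThreshold_of_riemannHypothesis`); unconditionally the tree
now holds `a*(S) ≥ (log 5)/2 − 1.2·10⁻⁴`. [cite: Bombieri2000Weil, §4 (Weil's criterion)] -/
theorem log_five_half_le_weilSemilocalThreshold_of_riemannHypothesis (hRH : Summit.RiemannHypothesis)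
    (h2 : 2 ∈ S) (h3 : 3 ∈ S) : Real.log 5 / 2 ≤ weilSemilocalThreshold S := by
  have h := le_weilSemilocalThreshold_of_riemannHypothesis hRH (primeFactors_subset_of_two_three h2 h3)
  rwa [log_five_half_eq] at h

/-- Contrapositive (the `{2,3}` door test): a threshold `a*(S) < (log 5)/2` for some `S ∋ 2, 3` would refute RH;
the proved lower end leaves a gap of `< 1.2·10⁻⁴` below the window. [cite: Bombieri2000Weil, §4 (Weil's criterion)] -/
theorem not_riemannHypothesis_of_weilSemilocalThreshold_two_three_lt (h2 : 2 ∈ S) (h3 : 3 ∈ S)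
    (h : weilSemilocalThreshold S < Real.log 5 / 2) : ¬ Summit.RiemannHypothesis := fun hRH ↦
  lt_irrefl _ (h.trans_le (log_five_half_le_weilSemilocalThreshold_of_riemannHypothesis hRH h2 h3))

end Summit.RiemannHypothesis.RiemannHypothesis.Theorems.SemilocalTwoThree

end
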